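import Summits.QuantumFields.GaugeBoot.RPBootstrapConvergenceZd
import Summits.QuantumFields.GaugeBoot.FullSpaceGroupBoundsConvergenceZd
import HarnessLib

/-!
# The SDP bounds with symmetry and reflection-positivity cuts converge to the extrema over the reflection-positive symmetric Gibbs states (gauge-boot, L1/L4 supplement)

HONEST FRAMING (cell `pub-gaugeboot`, page 1 of every file): the venture produces certified bounds
on lattice expectations at stated coupling, gauge group, dimension and torus size; NOT a mass gap,
NOT a continuum limit, NOT a string tension; NOT Yang–Mills-summit-bearing (barriers
`FixedCouplingUltralocality`, `PerturbativeInvisibility`). Structural; it certifies no number.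

## Content (`SU(N)` on `ℤ^d`, `β ≥ 0` where existence is needed, any polynomial observable `P`)

The `sup / inf` form of `RPBootstrapConvergenceZd`, parallel to `FullSpaceGroupBoundsConvergenceZd`:

* `rpDlrValuesSuN N β P` — expectations of `P` over the Gibbs states that are invariant under the
  full lattice symmetry and reflection positive for every site and link mirror;
  `⊆ fullDlrValues ⊆ invDlrValues ⊆ dlrValues`; sound at every level
  (`rpDlrValues_subset_rpFullSymLevelValuesZd_suN`); non-empty for `β ≥ 0`
  (`rpDlrValues_nonempty_bdd_suN`); `limitPointValues_subset_rpDlrValues_suN` — every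
  thermodynamic limit point's expectation is such a value;
* ★★★ `tendsto_sSup_rpFullSymLevelValuesZd_suN` / `tendsto_sInf_rpFullSymLevelValuesZd_suN`
  (`β ≥ 0`) — THE UPPER / LOWER BOUNDS OF KAZAKOV–ZHENG'S FULL INFINITE-LATTICE SDP converge, as the
  level grows, to `sup / inf` of `∫ P dμ` over the reflection-positive fully symmetric Gibbs states;
* ★★ `iSup_limitPoint_le_lim_sSup_rp_suN` — in particular the limit of the upper bounds dominates
  the plaquette (or any `P`) of EVERY thermodynamic limit point of the torus states;
  `sSup_rpDlrValues_le_suN` — the four limits are ordered: RP-symmetric `≤` symmetric `≤`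
  homogeneous `≤` all;
* ★★ `tendsto_sSup_rpFullSymLevelValuesZd_suN_of_small` — at strong coupling (`0 ≤ β`,
  `6(d-1)N β < 1`) all four hierarchies converge to the unique Gibbs value.

What this is NOT: `β < 0` (existence of RP states is then open here); diagonal mirrors; rates.

References: V. Kazakov, Z. Zheng, arXiv:2203.11360 §3, arXiv:2404.16925; K. Osterwalder, E. Seiler,
Ann. Phys. 110 (1978) 440. Folklore.
-/

noncomputable section

open MeasureTheory Filter Topology
open scoped ComplexOrder
open Literature.MathematicalPhysics.QuantumFieldTheory (LatticeRep)
open Literature.MathematicalPhysics.QuantumLattice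

namespace Summit.QuantumFields.GaugeBoot

section ZdSuN

variable {d : ℕ} (N : ℕ) (β : ℝ)

/-- **The reflection-positive fully symmetric Gibbs values of `P`.** [folklore] -/
def rpDlrValuesSuN (P : C(LGConfig d (Matrix.specialUnitaryGroup (Fin N) ℂ), ℝ)) : Set ℝ :=
  {t | ∃ μ ∈ ymGibbsMeasures (d := d) (fundamentalRep (Fin N)) β, IsZdTranslationInvariant μ ∧
    (∀ σ : Equiv.Perm (Fin d), μ.map (relabelConfig (edgePerm σ)) = μ) ∧
    (∀ i : Fin d, μ.map (configSiteReflect i) = μ) ∧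
    (∀ i : Fin d, IsReflectionPositiveFor (configSiteReflect (G := Matrix.specialUnitaryGroup (Fin N) ℂ) i)
      (siteHalfEdges i) μ) ∧
    (∀ i : Fin d, IsReflectionPositiveFor (configLinkReflect (G := Matrix.specialUnitaryGroup (Fin N) ℂ) i)
      (linkHalfEdges i) μ) ∧ ∫ U, P U ∂μ = t}

/-- RP-symmetric Gibbs values are fully symmetric Gibbs values. -/
theorem rpDlrValues_subset_fullDlrValues_suN (P : C(LGConfig d (Matrix.specialUnitaryGroup (Fin N) ℂ), ℝ)) :
    rpDlrValuesSuN (d := d) N β P ⊆ fullDlrValuesSuN (d := d) N β P := by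
  rintro t ⟨μ, hμ, hT, hperm, hrefl, -, -, rfl⟩
  exact ⟨μ, hμ, hT, hperm, hrefl, rfl⟩

/-- **Soundness at every level**: RP-symmetric Gibbs values are values of the SDP with everything. -/
theorem rpDlrValues_subset_rpFullSymLevelValuesZd_suN (n : ℕ)
    (P : C(LGConfig d (Matrix.specialUnitaryGroup (Fin N) ℂ), ℝ)) :
    rpDlrValuesSuN (d := d) N β P ⊆ rpFullSymLevelValuesZdSuN (d := d) N β n P := by
  rintro t ⟨μ, hμ, hT, hperm, hrefl, hsite, hlink, rfl⟩
  exact dlr_integral_mem_rpFullSymLevelValuesZd N β n hμ hT hperm hrefl hsite hlink P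

/-- **Every thermodynamic limit point's expectation is an RP-symmetric Gibbs value** (`β ≥ 0`). -/
theorem limitPointValues_subset_rpDlrValues_suN [NeZero d] {β : ℝ} (hβ : 0 ≤ β)
    {μ : Measure (LGConfig d (Matrix.specialUnitaryGroup (Fin N) ℂ))}
    (hμ : μ ∈ infiniteVolumeLimitPoints (d := d) (fundamentalRep (Fin N)) β)
    (P : C(LGConfig d (Matrix.specialUnitaryGroup (Fin N) ℂ), ℝ)) :
    ∫ U, P U ∂μ ∈ rpDlrValuesSuN (d := d) N β P := by
  haveI : SecondCountableTopology (Matrix (Fin N) (Fin N) ℂ) :=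
    inferInstanceAs (SecondCountableTopology (Fin N → Fin N → ℂ))
  haveI : SecondCountableTopology (Matrix.specialUnitaryGroup (Fin N) ℂ) :=
    Topology.IsEmbedding.subtypeVal.secondCountableTopology
  have hρ := continuous_fundamentalRep (Fin N)
  refine ⟨μ, mem_ymGibbsMeasures_of_mem_infiniteVolumeLimitPoints_holds (fundamentalRep (Fin N)) hρ hμ,
    isZdTranslationInvariant_of_mem_infiniteVolumeLimitPoints (fundamentalRep (Fin N)) hμ, fun σ => ?_,
    fun i => (reflectInvariant_of_mem_infiniteVolumeLimitPoints (fundamentalRep (Fin N)) hρ hμ i).map_eq,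
    siteRP_of_mem_infiniteVolumeLimitPoints (fundamentalRep (Fin N)) hρ hβ hμ,
    linkRP_of_mem_infiniteVolumeLimitPoints (fundamentalRep (Fin N)) hρ hβ hμ, rfl⟩
  have h := (permInvariant_of_mem_infiniteVolumeLimitPoints (fundamentalRep (Fin N)) hρ hμ σ).map_eq
  have he : (configPerm σ : LGConfig d (Matrix.specialUnitaryGroup (Fin N) ℂ) → _) = relabelConfig (edgePerm σ) :=
    funext (configPerm_eq_relabelConfig_edgePerm N σ)
  rwa [he] at h

/-- The RP-symmetric Gibbs values form a bounded set, non-empty for `β ≥ 0`. -/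
theorem rpDlrValues_nonempty_bdd_suN [NeZero d] {β : ℝ} (hβ : 0 ≤ β)
    (P : C(LGConfig d (Matrix.specialUnitaryGroup (Fin N) ℂ), ℝ)) :
    (rpDlrValuesSuN (d := d) N β P).Nonempty ∧ BddAbove (rpDlrValuesSuN (d := d) N β P) ∧
      BddBelow (rpDlrValuesSuN (d := d) N β P) := by
  obtain ⟨ν, hν, hT, hperm, hrefl, hsite, hlink⟩ := exists_dlr_rp_fullSpaceGroupInvariant_suN (d := d) N hβ
  obtain ⟨-, hA, hB⟩ := fullDlrValues_nonempty_bdd_suN N β P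
  exact ⟨⟨_, ν, hν, hT, hperm, hrefl, hsite, hlink, rfl⟩,
    hA.mono (rpDlrValues_subset_fullDlrValues_suN N β P), hB.mono (rpDlrValues_subset_fullDlrValues_suN N β P)⟩

/-- Boundedness and non-emptiness of the values with everything on the certificate domain (`β ≥ 0`). -/
theorem bdd_rpFullSymLevelValuesZd_suN [NeZero d] {β : ℝ} (hβ : 0 ≤ β) {n : ℕ}
    {P : C(LGConfig d (Matrix.specialUnitaryGroup (Fin N) ℂ), ℝ)} (hP : P ∈ certDomainZdSuN (d := d) N β n) :
    BddAbove (rpFullSymLevelValuesZdSuN (d := d) N β n P) ∧ BddBelow (rpFullSymLevelValuesZdSuN (d := d) N β n P) ∧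
      (rpFullSymLevelValuesZdSuN (d := d) N β n P).Nonempty := by
  obtain ⟨hA, hB, -⟩ := bdd_fullSymLevelValuesZd_suN N β hP
  have hsub := rpFullSymLevelValuesZd_subset_fullSym (d := d) N β n P
  exact ⟨hA.mono hsub, hB.mono hsub, rpFullSymLevelValuesZd_nonempty N hβ n P⟩

/-! ### The limits -/

/-- ★★★ **The upper bounds of Kazakov–Zheng's full infinite-lattice SDP converge to the supremum of
`∫ P dμ` over the reflection-positive fully symmetric Gibbs states** (`SU(N)`, `β ≥ 0`, any
polynomial `P`). [folklore] -/
theorem tendsto_sSup_rpFullSymLevelValuesZd_suN [NeZero d] {β : ℝ} (hβ : 0 ≤ β)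
    {P : C(LGConfig d (Matrix.specialUnitaryGroup (Fin N) ℂ), ℝ)}
    (hP : P ∈ polyAlgebra (ι := ZdEdge d) (fundamentalLatticeRep N)) :
    Tendsto (fun n => sSup (rpFullSymLevelValuesZdSuN (d := d) N β n P)) atTop
      (𝓝 (sSup (rpDlrValuesSuN (d := d) N β P))) := by
  obtain ⟨hDne, hDbdd, -⟩ := rpDlrValues_nonempty_bdd_suN (d := d) N hβ P
  set S := sSup (rpDlrValuesSuN (d := d) N β P)
  rw [Metric.tendsto_atTop]
  intro ε hε
  obtain ⟨n₁, hn₁⟩ := rpFullSymBootstrap_convergence_dlr_suN (d := d) N β hP (half_pos hε)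
  obtain ⟨n₂, hn₂⟩ := (eventually_mem_certDomainZd_suN N β hP).exists_forall_of_atTop
  refine ⟨max n₁ n₂, fun n hn => ?_⟩
  obtain ⟨hbdd, -, hne⟩ := bdd_rpFullSymLevelValuesZd_suN N hβ (hn₂ n ((le_max_right _ _).trans hn))
  have hup : sSup (rpFullSymLevelValuesZdSuN (d := d) N β n P) ≤ S + ε / 2 := by
    refine csSup_le hne fun t ht => ?_
    obtain ⟨μ, hμ, hT, hperm, hrefl, hsite, hlink, hclose⟩ :=
      hn₁ t (rpFullSymLevelValuesZd_anti N β ((le_max_left _ _).trans hn) P ht)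
    have h1 : ∫ U, P U ∂μ ≤ S := le_csSup hDbdd ⟨μ, hμ, hT, hperm, hrefl, hsite, hlink, rfl⟩
    linarith [(abs_le.1 hclose).2]
  have hlow : S ≤ sSup (rpFullSymLevelValuesZdSuN (d := d) N β n P) :=
    csSup_le_csSup hbdd hDne (rpDlrValues_subset_rpFullSymLevelValuesZd_suN N β n P)
  rw [Real.dist_eq, abs_lt]
  constructor <;> linarith

/-- ★★★ **The lower bounds converge to the infimum over the reflection-positive fully symmetric
Gibbs states** (`β ≥ 0`). [folklore] -/
theorem tendsto_sInf_rpFullSymLevelValuesZd_suN [NeZero d] {β : ℝ} (hβ : 0 ≤ β)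
    {P : C(LGConfig d (Matrix.specialUnitaryGroup (Fin N) ℂ), ℝ)}
    (hP : P ∈ polyAlgebra (ι := ZdEdge d) (fundamentalLatticeRep N)) :
    Tendsto (fun n => sInf (rpFullSymLevelValuesZdSuN (d := d) N β n P)) atTop
      (𝓝 (sInf (rpDlrValuesSuN (d := d) N β P))) := by
  obtain ⟨hDne, -, hDbdd⟩ := rpDlrValues_nonempty_bdd_suN (d := d) N hβ P
  set S := sInf (rpDlrValuesSuN (d := d) N β P)
  rw [Metric.tendsto_atTop]
  intro ε hε
  obtain ⟨n₁, hn₁⟩ := rpFullSymBootstrap_convergence_dlr_suN (d := d) N β hP (half_pos hε)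
  obtain ⟨n₂, hn₂⟩ := (eventually_mem_certDomainZd_suN N β hP).exists_forall_of_atTop
  refine ⟨max n₁ n₂, fun n hn => ?_⟩
  obtain ⟨-, hbdd, hne⟩ := bdd_rpFullSymLevelValuesZd_suN N hβ (hn₂ n ((le_max_right _ _).trans hn))
  have hlow : S - ε / 2 ≤ sInf (rpFullSymLevelValuesZdSuN (d := d) N β n P) := by
    refine le_csInf hne fun t ht => ?_
    obtain ⟨μ, hμ, hT, hperm, hrefl, hsite, hlink, hclose⟩ :=
      hn₁ t (rpFullSymLevelValuesZd_anti N β ((le_max_left _ _).trans hn) P ht)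
    have h1 : S ≤ ∫ U, P U ∂μ := csInf_le hDbdd ⟨μ, hμ, hT, hperm, hrefl, hsite, hlink, rfl⟩
    linarith [(abs_le.1 hclose).1]
  have hup : sInf (rpFullSymLevelValuesZdSuN (d := d) N β n P) ≤ S :=
    csInf_le_csInf hbdd hDne (rpDlrValues_subset_rpFullSymLevelValuesZd_suN N β n P)
  rw [Real.dist_eq, abs_lt]
  constructor <;> linarith

/-- ★★ **The limit of the upper bounds dominates every thermodynamic limit point** (`β ≥ 0`): for
every infinite-volume limit point `μ` of the torus Wilson states, `∫ P dμ ≤ sup rpDlrValues`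
`= lim_n sSup (rpFullSymLevelValuesZdSuN n)`; dually for the lower bounds. -/
theorem limitPoint_integral_mem_Icc_suN [NeZero d] {β : ℝ} (hβ : 0 ≤ β)
    {μ : Measure (LGConfig d (Matrix.specialUnitaryGroup (Fin N) ℂ))}
    (hμ : μ ∈ infiniteVolumeLimitPoints (d := d) (fundamentalRep (Fin N)) β)
    (P : C(LGConfig d (Matrix.specialUnitaryGroup (Fin N) ℂ), ℝ)) :
    sInf (rpDlrValuesSuN (d := d) N β P) ≤ ∫ U, P U ∂μ ∧
      ∫ U, P U ∂μ ≤ sSup (rpDlrValuesSuN (d := d) N β P) := by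
  obtain ⟨-, hA, hB⟩ := rpDlrValues_nonempty_bdd_suN (d := d) N hβ P
  have h := limitPointValues_subset_rpDlrValues_suN N hβ hμ P
  exact ⟨csInf_le hB h, le_csSup hA h⟩

/-- ★★ **The four limits are ordered**: RP-symmetric `≤` fully symmetric `≤` translation invariant
`≤` all Gibbs states (upper bounds; dually for lower bounds), `β ≥ 0`. -/
theorem sSup_rpDlrValues_le_suN [NeZero d] {β : ℝ} (hβ : 0 ≤ β)
    (P : C(LGConfig d (Matrix.specialUnitaryGroup (Fin N) ℂ), ℝ)) :
    sSup (rpDlrValuesSuN (d := d) N β P) ≤ sSup (fullDlrValuesSuN (d := d) N β P) ∧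
      sInf (fullDlrValuesSuN (d := d) N β P) ≤ sInf (rpDlrValuesSuN (d := d) N β P) := by
  obtain ⟨hRne, -, -⟩ := rpDlrValues_nonempty_bdd_suN (d := d) N hβ P
  obtain ⟨-, hFA, hFB⟩ := fullDlrValues_nonempty_bdd_suN (d := d) N β P
  exact ⟨csSup_le_csSup hFA hRne (rpDlrValues_subset_fullDlrValues_suN N β P),
    csInf_le_csInf hFB hRne (rpDlrValues_subset_fullDlrValues_suN N β P)⟩

/-! ### Strong coupling -/

/-- ★★ **At strong coupling (`0 ≤ β`, `6(d-1)N β < 1`) the bounds of the SDP with everything converge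
to the unique Gibbs value `∫ P dν`**: in the uniqueness window neither the symmetry reduction nor the
RP cuts change the limit. [folklore] -/
theorem tendsto_sSup_rpFullSymLevelValuesZd_suN_of_small [NeZero d] {β : ℝ} (hβ : 0 ≤ β)
    (hsmall : 6 * ((d - 1 : ℕ) : ℝ) * N * |β| < 1)
    {ν : Measure (LGConfig d (Matrix.specialUnitaryGroup (Fin N) ℂ))}
    (hν : ν ∈ ymGibbsMeasures (d := d) (fundamentalRep (Fin N)) β)
    {P : C(LGConfig d (Matrix.specialUnitaryGroup (Fin N) ℂ), ℝ)}
    (hP : P ∈ polyAlgebra (ι := ZdEdge d) (fundamentalLatticeRep N)) :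
    Tendsto (fun n => sSup (rpFullSymLevelValuesZdSuN (d := d) N β n P)) atTop (𝓝 (∫ U, P U ∂ν)) ∧
      Tendsto (fun n => sInf (rpFullSymLevelValuesZdSuN (d := d) N β n P)) atTop (𝓝 (∫ U, P U ∂ν)) := by
  have huniq : ∀ μ ∈ ymGibbsMeasures (d := d) (fundamentalRep (Fin N)) β, μ = ν := fun μ hμ =>
    subsingleton_ymGibbsMeasures_allGroups (fundamentalRep (Fin N)) (continuous_fundamentalRep _) hsmall hμ hν
  have h : rpDlrValuesSuN (d := d) N β P = {∫ U, P U ∂ν} := by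
    obtain ⟨⟨t, μ, hμ, hT, hperm, hrefl, hsite, hlink, rfl⟩, -, -⟩ := rpDlrValues_nonempty_bdd_suN (d := d) N hβ P
    ext s
    constructor
    · rintro ⟨μ', hμ', -, -, -, -, -, rfl⟩
      rw [huniq μ' hμ']
      rfl
    · rintro rfl
      exact ⟨μ, hμ, hT, hperm, hrefl, hsite, hlink, by rw [huniq μ hμ]⟩
  have h1 := tendsto_sSup_rpFullSymLevelValuesZd_suN N hβ hP
  have h2 := tendsto_sInf_rpFullSymLevelValuesZd_suN N hβ hP
  rw [h, csSup_singleton] at h1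
  rw [h, csInf_singleton] at h2
  exact ⟨h1, h2⟩

end ZdSuN

end Summit.QuantumFields.GaugeBoot

end
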